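import Summits.ABC.ABC.Theorems.TwistAmplificationSharpModerateLawCoreTransfer
import Summits.ABC.ABC.Theorems.TwistAmplificationSharpModerateLawTwistMinimalDefs
import Summits.ABC.ABC.Theorems.TwistAmplificationModerateWindowCountCalibration
import Summits.ABC.ABC.Theorems.TwistAmplificationSharpModerateLawCensusToDispersion
import Summits.ABC.ABC.Theorems.TwistAmplificationSharpModerateLawUniformityDischarge

/-!
# Crux `TwistAmplification.SharpModerateLaw` (stmt-ABC-1975): BC2-REDIRECT census, round r1 — kernel-checked part

Crux-strategist `planner-cstrat-stmt-ABC-1975-r1-0`, 2026-08-17 (EXEMPT-46 re-exam, verdict TRIVIAL-SEAM on the live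
registry D1/D2/E′).  Companion of `Cruxes/SharpModerateLaw/STRATEGY-CENSUS.md` v2 (§R1).  This file contains ONLY the
statements that are theorems of the tree or elementary real arithmetic; every claim of the census that is not here is
marked there as prose.  No `sorry`.

Contents
* §1 the frame every decomposition must fit: the crux is at least the summit (`crux_ge_summit`), and the crux follows
  from the two inversion summands (`crux_of_inversion_summands`, over the lead's landed `…TwistMinimalDefs`);
* §2 decomposition D-1 (live registry): its assembly as found, the certificate that the three pieces are ONE law
  (`d1_pieces_iff_one_law`) and jointly at least the summit (`d1_pieces_ge_summit`);
* §3 decomposition D-2 (twist-orbit inversion): the pointwise piece in Bombieri–Gubler form is EQUIVALENT to the summit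
  by LANDED theorems (`d2_pointwiseBG_iff_summit`) — clause (c) fails by a landed iff; the statistical piece is below the
  core (`d2_statistical_of_core`); and the TIGHTNESS IDENTITY (`threshold_identity`, `law_lt_threshold`,
  `plusOne_exponent`): replacing full Szpiro by weak Szpiro with exponent `K > 6` in the inversion yields exactly the
  amplification threshold `(K−κ)/(2K−6)`, which exceeds the law `1−κ/6` by the route's margin `(K−6)(κ−3)/(3(2K−6))` —
  so the pointwise piece cannot be weakened below the summit;
* §4 decomposition D-3 (the re-exam's suggested fix: Davenport–Heilbronn-by-radical × uniform Thue–Mahler per ring,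
  first moment): the two pieces TYPED over the tree's index-form vocabulary (`RingsByRadicalLaw`,
  `PerRingLawWithContent`, `PerRingLawPrimitive`) so that the census's trilemma refers to precise statements, and the
  piece `CoreLaw`-level certificate `core_ge_summit` used by horn (3c).
-/

noncomputable section

set_option linter.dupNamespace false

namespace Summit.ABC.ABC.Cruxes.SharpModerateLaw.RedirectCensus

open Summit.ABC.ABC.Theses.TwistAmplification
open Summit.ABC.ABC.Theorems
open Summit.ABC.ABC.Theorems.SharpModerateLaw
open Literature.NumberTheory.CubicFields
open UniqueFactorizationMonoid (radical)
open scoped BigOperators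

/-! ## §1 The frame -/

/-- The crux is at least the summit (landed `abc_of_sharpModerateLaw`): every decomposition `X₁ ∧ … ∧ X_k → crux`
proves `ABC` from its pieces. -/
theorem crux_ge_summit : SharpModerateLaw → _root_.ABC :=
  abc_of_sharpModerateLaw

/-- The crux from the two inversion summands and the inversion glue (lead c6's landed statements, `…TwistMinimalDefs`;
the glue `TwistOrbitInversion` is that lead's registered stub, provable, not assumed proved here). -/
theorem crux_of_inversion_summands (h₁ : CoreLawTM) (h₂ : PointwiseSzpiroCusp) (h₃ : TwistOrbitInversion) :
    SharpModerateLaw :=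
  sharpModerateLaw_of_coreLaw (h₃ h₁ h₂)

/-- The core is at least the summit (landed), used by horn (3c) of §4 and by D-2. -/
theorem core_ge_summit : CoreLaw → _root_.ABC :=
  abc_of_coreLaw

/-! ## §2 D-1 — the live registry (unit-plane v4.2): pieces D1 `LawWithConeE SpreadDeep6 1`, D2 `RingCensus6`,
E′ `CornerHallLaw6` -/

/-- D-1 assembly AS FOUND (the re-exam's TRIVIAL-SEAM: `flat6Cover_glue` = union bound over a population partition, then
the landed transfers act on the re-glued whole). -/
theorem d1_assembly_asFound (hD1 : UnitPlane.LawWithConeE UnitPlane.SpreadDeep6 1) (hD2 : UnitPlane.RingCensus6)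
    (hE : UnitPlane.CornerHallLaw6) : SharpModerateLaw :=
  UnitPlane.sharpModerateLaw_of_residue hD1 hD2 hE

/-- D-1's three pieces are ONE counting law cut along a partition of the counted population (landed residue theorem). -/
theorem d1_pieces_iff_one_law :
    (UnitPlane.LawWithConeE UnitPlane.SpreadDeep6 1 ∧ UnitPlane.RingCensus6 ∧ UnitPlane.CornerHallLaw6) ↔
      IndexFormShellLawCone :=
  UnitPlane.residue_iff_indexFormShellLawCone

/-- D-1's pieces are jointly at least the summit (landed). -/
theorem d1_pieces_ge_summit : UnitPlane.LawWithConeE UnitPlane.SpreadDeep6 1 → UnitPlane.RingCensus6 →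
    UnitPlane.CornerHallLaw6 → _root_.ABC :=
  UnitPlane.abc_of_unitPlaneResidue

/-! ## §3 D-2 — the twist-orbit inversion: pieces `CoreLawTM` (statistical), `PointwiseSzpiroCusp` /
`GeneralizedSzpiroConjectureBG` (pointwise), glue `TwistOrbitInversion` -/

/-- **Clause (c) fails for D-2 by a LANDED iff**: the pointwise piece in Bombieri–Gubler form is equivalent to the
summit (composition of the landed `ModerateWindowCount.iff_generalizedSzpiroBG` and `moderateWindowCount_equiv_abc`). -/
theorem d2_pointwiseBG_iff_summit :
    Literature.NumberTheory.EllipticCurves.GeneralizedSzpiroConjectureBG ↔ _root_.ABC :=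
  ModerateWindowCount.iff_generalizedSzpiroBG.symm.trans moderateWindowCount_equiv_abc

/-- The statistical piece is formally below the core (landed `coreLawTM_of_coreLaw`). -/
theorem d2_statistical_of_core : CoreLaw → CoreLawTM :=
  coreLawTM_of_coreLaw

/-- **Tightness identity of the inversion.** With weak Szpiro of exponent `K` in place of full Szpiro, the `+1` terms
of the inversion sum are cut at `d_K = (X^K/Y)^{1/(2K−6)}`; at `Y = X^κ` this is `X^{(K−κ)/(2K−6)}`
(`plusOne_exponent`), and `(K−κ)/(2K−6) − (1−κ/6) = (K−6)(κ−3)/(3(2K−6))` — the route's margin identity with `σ := K`. -/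
theorem threshold_identity (κ K : ℝ) (hK : K ≠ 3) :
    (K - κ) / (2 * K - 6) - (1 - κ / 6) = (K - 6) * (κ - 3) / (3 * (2 * K - 6)) := by
  have h : 2 * K - 6 ≠ 0 := by
    intro h0; apply hK; linarith
  have h3 : 3 * (2 * K - 6) ≠ 0 := mul_ne_zero (by norm_num) h
  have e1 : (K - κ) / (2 * K - 6) * (2 * K - 6) = K - κ := by
    rw [div_mul_eq_mul_div, mul_div_assoc, div_self h, mul_one]
  rw [eq_div_iff h3]
  have e2 : ((K - κ) / (2 * K - 6) - (1 - κ / 6)) * (3 * (2 * K - 6)) =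
      3 * ((K - κ) / (2 * K - 6) * (2 * K - 6)) - (1 - κ / 6) * (3 * (2 * K - 6)) := by ring
  rw [e2, e1]
  ring

/-- For `κ > 3` and `K > 6` the weak-Szpiro cut lands strictly ABOVE the law: the inversion with any pointwise input
weaker than full Szpiro (`K ↓ 6`) does not return the sharp exponent `1 − κ/6`. -/
theorem law_lt_threshold {κ K : ℝ} (hκ : 3 < κ) (hK : 6 < K) : 1 - κ / 6 < (K - κ) / (2 * K - 6) := by
  have h26 : 0 < 2 * K - 6 := by linarith
  rw [← sub_pos, threshold_identity κ K (by linarith)]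
  apply div_pos
  · nlinarith
  · linarith

/-- At `K = 6` (full Szpiro, `η → 0`) the cut is exactly the law: `(6−κ)/(2·6−6) = 1 − κ/6`. -/
theorem threshold_at_six (κ : ℝ) : (6 - κ) / (2 * 6 - 6) = 1 - κ / 6 := by ring

/-- The number of `+1` terms under weak Szpiro `K`: `((X^K)/(X^κ))^{1/(2K−6)} = X^{(K−κ)/(2K−6)}` for `X > 0`. -/
theorem plusOne_exponent {X : ℝ} (hX : 0 < X) (κ K : ℝ) :
    (X ^ K / X ^ κ) ^ (1 / (2 * K - 6)) = X ^ ((K - κ) / (2 * K - 6)) := by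
  rw [← Real.rpow_sub hX, ← Real.rpow_mul hX.le]
  congr 1
  ring

/-! ## §4 D-3 — the re-exam's suggested fix, typed: (i) maximal cubic rings counted by RADICAL of the discriminant,
(ii) a uniform Thue–Mahler count per ring, (iii) first-moment assembly `totalCount ≤ Σ_rings (per-ring count)` -/

open scoped Classical in
/-- (i) **Rings by radical** — the number of `GL₂(ℤ)`-classes of MAXIMAL binary cubic forms (maximal cubic rings) with
`0 < |Disc| ≤ ⌈2Y⌉` and `rad(|Disc|) ≤ X`, as a function of `(X, Y)`. -/
def ringCountByRadical (X Y : ℝ) : ℕ :=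
  ∑ D ∈ (Finset.Icc (-(⌈2 * Y⌉₊ : ℤ)) (⌈2 * Y⌉₊ : ℤ)).erase 0,
    if ((radical D.natAbs : ℕ) : ℝ) ≤ X then orbitTotal D (fun F => if RingOfForm.IsMaximal F then 1 else 0) else 0

/-- (i) as a LAW of Davenport–Heilbronn type "by radical": `#rings(X, Y) ≤ C_ε (XY)^ε · X`.  (Plausible and of the
right type; but note the tree's `card_negReducibleMaximalOrbits` / `card_posReducibleMaximalOrbits` (BTT 2023 Prop. 4.2):
already the REDUCIBLE maximal rings with `|Disc| ≤ X` are in bijection with the fundamental discriminants in that range,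
so `#rings(X, Y) ≥ c·X` for `Y ≥ X` — the count is `X^{1+o(1)}`, not smaller.) -/
def RingsByRadicalLaw : Prop :=
  ∀ ε : ℝ, 0 < ε → ∃ C : ℝ, ∀ X Y : ℝ, 1 ≤ X → 1 ≤ Y →
    (ringCountByRadical X Y : ℝ) ≤ C * (X * Y) ^ ε * X

/-- (ii) **Uniform Thue–Mahler count per ring, WITH content** (twists included): for every maximal form `F`, the
index-form shell `ifShell F X Y` (tower-free content, `Y ≤ M⁺ < 2Y`, `N5 ≤ X`) obeys the law uniformly in `F` on the
cone.  Horn (3a) of the census: specialised to the SPLIT form (`Disc = 1`, the ring `ℤ³`) its data with content `d`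
are the Frey–twist data `(a, b, c, d)` of `FreyAmplification` (stmt-ABC-2778, landed `FreyAmplification_proof`), so
this piece ALONE is at least the summit. -/
def PerRingLawWithContent : Prop :=
  ∀ σ : ℝ, 6 < σ → ∀ ε : ℝ, 0 < ε → ∃ C : ℝ, ∀ F : BinaryCubic ℤ, RingOfForm.IsMaximal F →
    ∀ X Y : ℝ, 1 ≤ X → 1 ≤ Y → X ^ 3 ≤ 2 * Y → Y ≤ 186624 * X ^ σ →
      (Set.ncard (ifShell F X Y) : ℝ) ≤ C * (X * Y) ^ ε * (X * Y ^ (-(1 / 6 : ℝ)) + 1)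

/-- (ii′) **Uniform power-saving Thue–Mahler count per ring, PRIMITIVE points only** (`gcd(u, v) = 1`), with the
uniform bound `C_ε (XY)^ε` the first-moment assembly would need.  Horn (3b): FALSE for the split form — the Frey data of
`1 + (t^k − 1) = t^k` put `≫ X^{1−κ/6−o(1)}` primitive points of `ℤ³` into one shell at `κ = 6k/(k+1)` (Disproof F1/F3:
clean-Belyi families sit exactly on the law). -/
def PerRingLawPrimitive : Prop :=
  ∀ σ : ℝ, 6 < σ → ∀ ε : ℝ, 0 < ε → ∃ C : ℝ, ∀ F : BinaryCubic ℤ, RingOfForm.IsMaximal F →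
    ∀ X Y : ℝ, 1 ≤ X → 1 ≤ Y → X ^ 3 ≤ 2 * Y → Y ≤ 186624 * X ^ σ →
      (Set.ncard {q : ℤ × ℤ | q ∈ ifShell F X Y ∧ Int.gcd q.1 q.2 = 1} : ℝ) ≤ C * (X * Y) ^ ε

/-- (iii) the loss of the first-moment assembly, as arithmetic: with `#rings ≍ X` (i) and `+1` per ring (ii), the
bound at `Y = X^κ` is `≥ X = X^{1−κ/6} · X^{κ/6}`; the loss exponent `κ/6` is positive on the whole window. -/
theorem firstMoment_loss_pos {κ : ℝ} (hκ : 3 < κ) : 0 < κ / 6 ∧ (1 - κ / 6) + κ / 6 = 1 :=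
  ⟨by linarith, by ring⟩

end Summit.ABC.ABC.Cruxes.SharpModerateLaw.RedirectCensus

end
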